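import Literature.InformationTheory.QuantumCodes.TwoBlockCodeEquivalences
import Literature.InformationTheory.QuantumCodes.CSSEquivalenceNoise
import Literature.InformationTheory.QuantumCodes.CSSThresholdConverses
import HarnessLib

/-!
# Abelian two-block (bivariate-bicycle, generalized-bicycle) codes: the two error sectors have identical
# noise behaviour; `y₀ ≤ 1/2` and `p₀ ≤ 1/4` for every decoder of every such family

Topic `Literature/InformationTheory/QuantumCodes` (venture QEC, LADDER-QEC rung Q5; qec-lit-2 gen 4). For the
abelian two-block code `AbelianTwoBlock.css a b` (`H_X = [A|B]`, `H_Z = [Bᵀ|Aᵀ]`, `A, B` circulants of an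
abelian group `G`; the bivariate-bicycle codes are `G = ℤ_ℓ × ℤ_m`, `BB.Code.css_eq`), Bravyi et al. prove
Lemma 1 («The code offers equal distance for X-type and Z-type errors») by the re-indexing
`H^Z = C H^X [[0,C],[C,0]]` — the tree's `AbelianTwoBlock.HZ_eq_submatrix`: `H_Z` is `H_X` with rows relabelled by
`g ↦ -g` and columns by the involution `colSwap : L g ↦ R(-g), R g ↦ L(-g)`. This file records that identity as
`(css a b).swap = (css a b).reindex …` (`css_swap_eq_reindex`) and transports the Q5 NOISE functionals along it
(`CSSEquivalenceNoise.lean`), with the converse bounds of `CSSThresholdConverses.lean` as consequences. All PROVED;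
no named fact; no definition (the transported decoder is the lambda `s ↦ D(s ∘ (-·)) ∘ colSwap`).

* `xUncorrectableProb_eq` — `P^X_y[erasure uncorrectable] = P^Z_y[erasure uncorrectable]` for every `y`;
* `xFailure_transport_eq` — for every decoder `D` of the `X`-syndrome (phase flips), the transported decoder of the
  `Z`-syndrome fails on bit flips with the same probability at every rate `p`; `zFailure_transport_eq` likewise;
* single code with `k ≥ 1`: `one_le_uncorrectableProb_add_self` (`1 ≤ P^Z_y + P^Z_{1-y}`),
  `half_le_uncorrectableProb_half` (`P^Z_{1/2}[uncorrectable] ≥ 1/2`), `half_le_zFailure_add_self`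
  (`1/2 ≤ P^Z_p[D fails] + P^Z_{1/2-p}[D fails]`) and **`quarter_le_zFailure_quarter`: EVERY decoder of EVERY
  abelian two-block code with `k ≥ 1` fails with probability `≥ 1/4` on independent phase flips of rate `1/4`**
  (and the `X`-sector twins);
* families `i ↦ css (a i) (b i)` with `k ≥ 1`: `erasure_threshold_le_half` (`y₀ ≤ 1/2`), `capacity_threshold_le_quarter`
  (`p₀ ≤ 1/4` for EVERY decoder family), both sectors, with `accuracyThreshold` forms;
* `BB.Code` restatements (`BB.Code.quarter_le_zFailure_quarter`, …) by `rfl` along `BB.Code.css_eq`.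

HONEST FRAMING: certified CEILINGS on thresholds / FLOORS on failure probabilities; the numerically observed
bivariate-bicycle pseudo-thresholds (`≈ .7%` circuit noise, BP-OSD; Bravyi et al. 2024) are VALIDATED-column
numbers for a different noise model and are not compared here.

## References

* [BravyiEtAl2024] S. Bravyi et al., *High-threshold and low-overhead fault-tolerant quantum memory*, Nature 627
  (2024) 778 = arXiv:2308.07915, §4 Lemma 1 and its proof (`H^Z = C H^X [[0,C],[C,0]]`, «equal distance for
  X-type and Z-type errors»; tree: `AbelianTwoBlock.HZ_eq_submatrix`, `css_dX_eq_dZ`), SI §9.3 (the ZX-duality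
  permutation).
* [LinPryadko2024] H.-K. Lin, L. P. Pryadko, PRA 109 (2024) 022407 = arXiv:2306.16400, §4.2 Thm 6 (v)–(vi)
  (abelian `G`: `LP[a,b] ≅ LP[b,a]`, the CSS-dual code; tree: `TwoBlockCodeEquivalences.lean`).
* [StaceBarrettDoherty2009] T. M. Stace, S. D. Barrett, A. C. Doherty, PRL 102 (2009) 200501, p. 2 (no-cloning
  bound on the loss threshold) — via `CSSThresholdConverses.lean`.
* [RichardsonUrbanke2008] T. Richardson, R. Urbanke, *Modern Coding Theory*, Lemma 4.78 (Erasure Decomposition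
  Lemma) — via `CSSThresholdConverses.lean`.
-/

noncomputable section

namespace Literature.InformationTheory.QuantumCodes

open Finset Matrix Filter Topology

namespace AbelianTwoBlock

section OneCode

variable {G : Type*} [Fintype G] [AddCommGroup G] [DecidableEq G]

omit [DecidableEq G] in
/-- **The `X ↔ Z` exchange of an abelian two-block code is a re-indexing of the code**: rows by `g ↦ -g` on both
check families, qubits by `colSwap` (`H^Z = C H^X [[0,C],[C,0]]`).
[cite: BravyiEtAl2024, §4 proof of Lemma 1 (H^Z = C H^X [[0,C],[C,0]])] -/
theorem css_swap_eq_reindex (a b : G → ZMod 2) :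
    (css a b).swap = (css a b).reindex (Equiv.neg G).symm (Equiv.neg G).symm (colSwap G).symm :=
  CSSCode.eq_reindex_of_submatrix (C := css a b) (C' := (css a b).swap) (ρX := Equiv.neg G)
    (ρZ := Equiv.neg G) (σ := colSwap G) (HZ_eq_submatrix a b) (HX_eq_submatrix a b)

/-- **Both sectors have the same erasure behaviour**: `P^X_y[erasure uncorrectable] = P^Z_y[erasure
uncorrectable]` for every abelian two-block code and every erasure rate `y`.
[cite: BravyiEtAl2024, §4 Lemma 1 (equal distance for X-type and Z-type errors) and its proof] -/
theorem xUncorrectableProb_eq (a b : G → ZMod 2) (y : ℝ) :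
    ErasureDecoder.uncorrectableProb {x : G ⊕ G → ZMod 2 | (css a b).HZ *ᵥ x = 0}
        ((css a b).rowSpX : Set (G ⊕ G → ZMod 2)) y =
      ErasureDecoder.uncorrectableProb {x : G ⊕ G → ZMod 2 | (css a b).HX *ᵥ x = 0}
        ((css a b).rowSpZ : Set (G ⊕ G → ZMod 2)) y := by
  change ErasureDecoder.uncorrectableProb {x : G ⊕ G → ZMod 2 | (css a b).swap.HX *ᵥ x = 0}
      ((css a b).swap.rowSpZ : Set (G ⊕ G → ZMod 2)) y = _
  rw [css_swap_eq_reindex, CSSCode.uncorrectableProb_reindex]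

open Classical in
/-- **Transported decoders, `Z ↦ X`**: for every decoder `D` of the `X`-syndrome (phase flips), the decoder
`s ↦ D(s ∘ (-·)) ∘ colSwap` of the `Z`-syndrome fails on independent bit flips of rate `p` with exactly the
probability with which `D` fails on independent phase flips of rate `p`.
[cite: BravyiEtAl2024, SI §9.3 (the ZX-duality permutation) with §4 proof of Lemma 1] -/
theorem xFailure_transport_eq (a b : G → ZMod 2) (D : Decoder (G → ZMod 2) (G ⊕ G → ZMod 2)) (p : ℝ) :
    (∑ e ∈ univ.filter (fun e : G ⊕ G → ZMod 2 =>
        ¬ Decoder.Corrects (fun s : G → ZMod 2 => D (s ∘ (Equiv.neg G).symm) ∘ (colSwap G).symm.symm)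
          (css a b).xSyndrome ((css a b).rowSpX : Set (G ⊕ G → ZMod 2)) e), bernoulliWeight p (supp e)) =
      ∑ e ∈ univ.filter (fun e : G ⊕ G → ZMod 2 =>
        ¬ D.Corrects (css a b).zSyndrome ((css a b).rowSpZ : Set (G ⊕ G → ZMod 2)) e),
        bernoulliWeight p (supp e) := by
  change (∑ e ∈ univ.filter (fun e : G ⊕ G → ZMod 2 =>
        ¬ Decoder.Corrects (fun s : G → ZMod 2 => D (s ∘ (Equiv.neg G).symm) ∘ (colSwap G).symm.symm)
          (css a b).swap.zSyndrome ((css a b).swap.rowSpZ : Set (G ⊕ G → ZMod 2)) e),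
          bernoulliWeight p (supp e)) = _
  rw [css_swap_eq_reindex]
  exact CSSCode.zFailure_reindex (css a b) (Equiv.neg G).symm (Equiv.neg G).symm (colSwap G).symm D p

/-! #### Consequences for one code with `k ≥ 1` -/

/-- **`1 ≤ P^Z_y[uncorrectable] + P^Z_{1-y}[uncorrectable]`** for every abelian two-block code with `k ≥ 1`.
[cite: StaceBarrettDoherty2009, p. 2 (no-cloning bound on p_loss); BravyiEtAl2024, §4 Lemma 1] -/
theorem one_le_uncorrectableProb_add_self (a b : G → ZMod 2) (hk : 0 < (css a b).k) {y : ℝ} (hy0 : 0 ≤ y)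
    (hy1 : y ≤ 1) :
    1 ≤ ErasureDecoder.uncorrectableProb {x : G ⊕ G → ZMod 2 | (css a b).HX *ᵥ x = 0}
          ((css a b).rowSpZ : Set (G ⊕ G → ZMod 2)) y +
        ErasureDecoder.uncorrectableProb {x : G ⊕ G → ZMod 2 | (css a b).HX *ᵥ x = 0}
          ((css a b).rowSpZ : Set (G ⊕ G → ZMod 2)) (1 - y) := by
  have h := (css a b).one_le_uncorrectableProb_add hk hy0 hy1
  rwa [xUncorrectableProb_eq] at h

/-- **At erasure rate `1/2` every abelian two-block code loses its logical information with probability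
`≥ 1/2`** (`k ≥ 1`; one sector). [cite: StaceBarrettDoherty2009, p. 2 (p_loss < 0.5 no-cloning bound)] -/
theorem half_le_uncorrectableProb_half (a b : G → ZMod 2) (hk : 0 < (css a b).k) :
    1 / 2 ≤ ErasureDecoder.uncorrectableProb {x : G ⊕ G → ZMod 2 | (css a b).HX *ᵥ x = 0}
      ((css a b).rowSpZ : Set (G ⊕ G → ZMod 2)) (1 / 2) := by
  have h := one_le_uncorrectableProb_add_self a b hk (y := 1 / 2) (by norm_num) (by norm_num)
  rw [show (1 : ℝ) - 1 / 2 = 1 / 2 by norm_num] at h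
  linarith

open Classical in
/-- **`1/2 ≤ P^Z_p[D fails] + P^Z_{p'}[D fails]` whenever `p + p' = 1/2`**, for EVERY decoder `D` of the
`X`-syndrome of an abelian two-block code with `k ≥ 1`. [cite: RichardsonUrbanke2008, Lemma 4.78; BravyiEtAl2024, §4 Lemma 1] -/
theorem half_le_zFailure_add_self (a b : G → ZMod 2) (hk : 0 < (css a b).k)
    (D : Decoder (G → ZMod 2) (G ⊕ G → ZMod 2)) {p p' : ℝ} (hp0 : 0 ≤ p) (hp'0 : 0 ≤ p')
    (hsum : p + p' = 1 / 2) :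
    1 / 2 ≤ (∑ e ∈ univ.filter (fun e : G ⊕ G → ZMod 2 =>
          ¬ D.Corrects (css a b).zSyndrome ((css a b).rowSpZ : Set (G ⊕ G → ZMod 2)) e),
          bernoulliWeight p (supp e)) +
      ∑ e ∈ univ.filter (fun e : G ⊕ G → ZMod 2 =>
          ¬ D.Corrects (css a b).zSyndrome ((css a b).rowSpZ : Set (G ⊕ G → ZMod 2)) e),
          bernoulliWeight p' (supp e) := by
  have h := (css a b).half_le_zFailure_add_xFailure hk D
    (fun s : G → ZMod 2 => D (s ∘ (Equiv.neg G).symm) ∘ (colSwap G).symm.symm) hp0 hp'0 hsum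
  rwa [xFailure_transport_eq] at h

open Classical in
/-- **★ EVERY decoder of EVERY abelian two-block code with `k ≥ 1` fails with probability `≥ 1/4` on
independent phase flips of rate `1/4`.** [cite: RichardsonUrbanke2008, Lemma 4.78 (Erasure Decomposition Lemma); BravyiEtAl2024, §4 Lemma 1] -/
theorem quarter_le_zFailure_quarter (a b : G → ZMod 2) (hk : 0 < (css a b).k)
    (D : Decoder (G → ZMod 2) (G ⊕ G → ZMod 2)) :
    1 / 4 ≤ ∑ e ∈ univ.filter (fun e : G ⊕ G → ZMod 2 =>
        ¬ D.Corrects (css a b).zSyndrome ((css a b).rowSpZ : Set (G ⊕ G → ZMod 2)) e),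
        bernoulliWeight (1 / 4) (supp e) := by
  have h := half_le_zFailure_add_self a b hk D (p := 1 / 4) (p' := 1 / 4) (by norm_num) (by norm_num)
    (by norm_num)
  linarith

/-- `X`-sector twin of `half_le_uncorrectableProb_half` (the `X`-sector of `css a b` is the `Z`-sector of the dual
pair `css b(-·) a(-·)`, which has the same `k`). [cite: LinPryadko2024, §4.2 Thm 6(vi) (the CSS-dual code)] -/
theorem half_le_xUncorrectableProb_half (a b : G → ZMod 2) (hk : 0 < (css a b).k) :
    1 / 2 ≤ ErasureDecoder.uncorrectableProb {x : G ⊕ G → ZMod 2 | (css a b).HZ *ᵥ x = 0}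
      ((css a b).rowSpX : Set (G ⊕ G → ZMod 2)) (1 / 2) := by
  rw [xUncorrectableProb_eq]
  exact half_le_uncorrectableProb_half a b hk

open Classical in
/-- **`X`-sector twin: every decoder of the `Z`-syndrome fails with probability `≥ 1/4` on independent bit flips
of rate `1/4`** (`k ≥ 1`). [cite: LinPryadko2024, §4.2 Thm 6(vi) (the CSS-dual code); RichardsonUrbanke2008, Lemma 4.78] -/
theorem quarter_le_xFailure_quarter (a b : G → ZMod 2) (hk : 0 < (css a b).k)
    (D : Decoder (G → ZMod 2) (G ⊕ G → ZMod 2)) :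
    1 / 4 ≤ ∑ e ∈ univ.filter (fun e : G ⊕ G → ZMod 2 =>
        ¬ D.Corrects (css a b).xSyndrome ((css a b).rowSpX : Set (G ⊕ G → ZMod 2)) e),
        bernoulliWeight (1 / 4) (supp e) := by
  have hk' : 0 < (css (fun g => b (-g)) (fun g => a (-g))).k := by rwa [css_dual_k]
  have h := quarter_le_zFailure_quarter (fun g => b (-g)) (fun g => a (-g)) hk' D
  rw [css_dual_eq_swap] at h
  exact h

end OneCode

/-! ### Families of abelian two-block codes: `y₀ ≤ 1/2`, `p₀ ≤ 1/4`, every decoder -/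

section Family

variable {G : ℕ → Type*} [∀ i, Fintype (G i)] [∀ i, AddCommGroup (G i)] [∀ i, DecidableEq (G i)]

/-- **Erasure threshold `≤ 1/2`, `Z`-sector**, for every family of abelian two-block codes with `k ≥ 1`.
[cite: StaceBarrettDoherty2009, p. 2 (no-cloning bound on p_loss); BravyiEtAl2024, §4 Lemma 1] -/
theorem erasure_threshold_le_half (a b : ∀ i, G i → ZMod 2) (hk : ∀ i, 0 < (css (a i) (b i)).k) {t : ℝ}
    (ht : IsThresholdLowerBound (fun i y => ErasureDecoder.uncorrectableProb
      {x : G i ⊕ G i → ZMod 2 | (css (a i) (b i)).HX *ᵥ x = 0}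
      ((css (a i) (b i)).rowSpZ : Set (G i ⊕ G i → ZMod 2)) y) t) :
    t ≤ 1 / 2 :=
  erasure_threshold_le_half_of_symm (fun i => css (a i) (b i)) hk (fun i y => xUncorrectableProb_eq (a i) (b i) y) ht

/-- **Erasure threshold `≤ 1/2`, `X`-sector.** [cite: StaceBarrettDoherty2009, p. 2; LinPryadko2024, §4.2 Thm 6(vi)] -/
theorem x_erasure_threshold_le_half (a b : ∀ i, G i → ZMod 2) (hk : ∀ i, 0 < (css (a i) (b i)).k) {t : ℝ}
    (ht : IsThresholdLowerBound (fun i y => ErasureDecoder.uncorrectableProb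
      {x : G i ⊕ G i → ZMod 2 | (css (a i) (b i)).HZ *ᵥ x = 0}
      ((css (a i) (b i)).rowSpX : Set (G i ⊕ G i → ZMod 2)) y) t) :
    t ≤ 1 / 2 := by
  have heq : (fun i y => ErasureDecoder.uncorrectableProb
      {x : G i ⊕ G i → ZMod 2 | (css (a i) (b i)).HZ *ᵥ x = 0}
      ((css (a i) (b i)).rowSpX : Set (G i ⊕ G i → ZMod 2)) y) =
    (fun i y => ErasureDecoder.uncorrectableProb
      {x : G i ⊕ G i → ZMod 2 | (css (a i) (b i)).HX *ᵥ x = 0}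
      ((css (a i) (b i)).rowSpZ : Set (G i ⊕ G i → ZMod 2)) y) := by
    funext i y
    exact xUncorrectableProb_eq (a i) (b i) y
  rw [heq] at ht
  exact erasure_threshold_le_half a b hk ht

/-- **Erasure accuracy threshold `≤ 1/2`** (both sectors) for every family of abelian two-block codes with
`k ≥ 1`. [cite: StaceBarrettDoherty2009, p. 2 (no-cloning bound on p_loss)] -/
theorem erasure_accuracyThreshold_le_half (a b : ∀ i, G i → ZMod 2) (hk : ∀ i, 0 < (css (a i) (b i)).k) :
    accuracyThreshold (fun i y => ErasureDecoder.uncorrectableProb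
        {x : G i ⊕ G i → ZMod 2 | (css (a i) (b i)).HX *ᵥ x = 0}
        ((css (a i) (b i)).rowSpZ : Set (G i ⊕ G i → ZMod 2)) y) ≤ 1 / 2 ∧
      accuracyThreshold (fun i y => ErasureDecoder.uncorrectableProb
        {x : G i ⊕ G i → ZMod 2 | (css (a i) (b i)).HZ *ᵥ x = 0}
        ((css (a i) (b i)).rowSpX : Set (G i ⊕ G i → ZMod 2)) y) ≤ 1 / 2 :=
  ⟨erasure_threshold_le_half a b hk (isThresholdLowerBound_accuracyThreshold _),
    x_erasure_threshold_le_half a b hk (isThresholdLowerBound_accuracyThreshold _)⟩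

open Classical in
/-- **Code-capacity threshold `≤ 1/4`, `Z`-sector, EVERY decoder family**, for every family of abelian two-block
codes with `k ≥ 1`. [cite: RichardsonUrbanke2008, Lemma 4.78 (Erasure Decomposition Lemma); BravyiEtAl2024, §4 Lemma 1] -/
theorem capacity_threshold_le_quarter (a b : ∀ i, G i → ZMod 2) (hk : ∀ i, 0 < (css (a i) (b i)).k)
    (D : ∀ i, Decoder (G i → ZMod 2) (G i ⊕ G i → ZMod 2)) {t : ℝ}
    (ht : IsThresholdLowerBound (fun i p => ∑ e ∈ univ.filter (fun e : G i ⊕ G i → ZMod 2 =>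
        ¬ (D i).Corrects (css (a i) (b i)).zSyndrome ((css (a i) (b i)).rowSpZ : Set (G i ⊕ G i → ZMod 2)) e),
        bernoulliWeight p (supp e)) t) :
    t ≤ 1 / 4 :=
  capacity_threshold_le_quarter_of_symm (fun i => css (a i) (b i)) hk D
    (fun i => fun s : G i → ZMod 2 => D i (s ∘ (Equiv.neg (G i)).symm) ∘ (colSwap (G i)).symm.symm)
    (fun i p => xFailure_transport_eq (a i) (b i) (D i) p) ht

open Classical in
/-- **Code-capacity threshold `≤ 1/4`, `X`-sector, EVERY decoder family** (via the dual pairs `css b(-·) a(-·)`,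
whose `Z`-sectors are these `X`-sectors). [cite: LinPryadko2024, §4.2 Thm 6(vi); RichardsonUrbanke2008, Lemma 4.78] -/
theorem x_capacity_threshold_le_quarter (a b : ∀ i, G i → ZMod 2) (hk : ∀ i, 0 < (css (a i) (b i)).k)
    (D : ∀ i, Decoder (G i → ZMod 2) (G i ⊕ G i → ZMod 2)) {t : ℝ}
    (ht : IsThresholdLowerBound (fun i p => ∑ e ∈ univ.filter (fun e : G i ⊕ G i → ZMod 2 =>
        ¬ (D i).Corrects (css (a i) (b i)).xSyndrome ((css (a i) (b i)).rowSpX : Set (G i ⊕ G i → ZMod 2)) e),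
        bernoulliWeight p (supp e)) t) :
    t ≤ 1 / 4 := by
  have hk' : ∀ i, 0 < (css (fun g => b i (-g)) (fun g => a i (-g))).k := fun i => by
    rw [css_dual_k]; exact hk i
  have heq : (fun i p => ∑ e ∈ univ.filter (fun e : G i ⊕ G i → ZMod 2 =>
        ¬ (D i).Corrects (css (a i) (b i)).xSyndrome ((css (a i) (b i)).rowSpX : Set (G i ⊕ G i → ZMod 2)) e),
        bernoulliWeight p (supp e)) =
      (fun i p => ∑ e ∈ univ.filter (fun e : G i ⊕ G i → ZMod 2 =>
        ¬ (D i).Corrects (css (fun g => b i (-g)) (fun g => a i (-g))).zSyndrome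
          ((css (fun g => b i (-g)) (fun g => a i (-g))).rowSpZ : Set (G i ⊕ G i → ZMod 2)) e),
        bernoulliWeight p (supp e)) := by
    funext i p
    rw [css_dual_eq_swap]
    rfl
  rw [heq] at ht
  exact capacity_threshold_le_quarter (fun i => fun g => b i (-g)) (fun i => fun g => a i (-g)) hk' D ht

open Classical in
/-- **Code-capacity accuracy threshold `≤ 1/4`** (`Z`-sector, every decoder family) for every family of abelian
two-block codes with `k ≥ 1`. [cite: RichardsonUrbanke2008, Lemma 4.78; BravyiEtAl2024, §4 Lemma 1] -/
theorem capacity_accuracyThreshold_le_quarter (a b : ∀ i, G i → ZMod 2) (hk : ∀ i, 0 < (css (a i) (b i)).k)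
    (D : ∀ i, Decoder (G i → ZMod 2) (G i ⊕ G i → ZMod 2)) :
    accuracyThreshold (fun i p => ∑ e ∈ univ.filter (fun e : G i ⊕ G i → ZMod 2 =>
        ¬ (D i).Corrects (css (a i) (b i)).zSyndrome ((css (a i) (b i)).rowSpZ : Set (G i ⊕ G i → ZMod 2)) e),
        bernoulliWeight p (supp e)) ≤ 1 / 4 :=
  capacity_threshold_le_quarter a b hk D (isThresholdLowerBound_accuracyThreshold _)

end Family

end AbelianTwoBlock

/-! ### Bivariate-bicycle restatements (`BB.Code.css = AbelianTwoBlock.css (coeffVec A) (coeffVec B)`, `rfl`) -/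

namespace BB.Code

variable {ℓ m : ℕ} [NeZero ℓ] [NeZero m]

/-- **Both sectors of a bivariate-bicycle code have the same erasure behaviour.**
[cite: BravyiEtAl2024, §4 Lemma 1 (equal distance for X-type and Z-type errors) and its proof] -/
theorem xUncorrectableProb_eq (C : BB.Code ℓ m) (y : ℝ) :
    ErasureDecoder.uncorrectableProb {x : Mono ℓ m ⊕ Mono ℓ m → ZMod 2 | C.css.HZ *ᵥ x = 0}
        (C.css.rowSpX : Set (Mono ℓ m ⊕ Mono ℓ m → ZMod 2)) y =
      ErasureDecoder.uncorrectableProb {x : Mono ℓ m ⊕ Mono ℓ m → ZMod 2 | C.css.HX *ᵥ x = 0}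
        (C.css.rowSpZ : Set (Mono ℓ m ⊕ Mono ℓ m → ZMod 2)) y :=
  AbelianTwoBlock.xUncorrectableProb_eq (coeffVec C.A) (coeffVec C.B) y

/-- **At erasure rate `1/2` a bivariate-bicycle code with `k ≥ 1` is uncorrectable with probability `≥ 1/2`.**
[cite: StaceBarrettDoherty2009, p. 2 (p_loss < 0.5 no-cloning bound); BravyiEtAl2024, §4 Lemma 1] -/
theorem half_le_uncorrectableProb_half (C : BB.Code ℓ m) (hk : 0 < C.css.k) :
    1 / 2 ≤ ErasureDecoder.uncorrectableProb {x : Mono ℓ m ⊕ Mono ℓ m → ZMod 2 | C.css.HX *ᵥ x = 0}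
      (C.css.rowSpZ : Set (Mono ℓ m ⊕ Mono ℓ m → ZMod 2)) (1 / 2) :=
  AbelianTwoBlock.half_le_uncorrectableProb_half (coeffVec C.A) (coeffVec C.B) hk

open Classical in
/-- **Every decoder of a bivariate-bicycle code with `k ≥ 1` fails with probability `≥ 1/4` on independent phase
flips of rate `1/4`.** [cite: RichardsonUrbanke2008, Lemma 4.78 (Erasure Decomposition Lemma); BravyiEtAl2024, §4 Lemma 1] -/
theorem quarter_le_zFailure_quarter (C : BB.Code ℓ m) (hk : 0 < C.css.k)
    (D : Decoder (Mono ℓ m → ZMod 2) (Mono ℓ m ⊕ Mono ℓ m → ZMod 2)) :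
    1 / 4 ≤ ∑ e ∈ univ.filter (fun e : Mono ℓ m ⊕ Mono ℓ m → ZMod 2 =>
        ¬ D.Corrects C.css.zSyndrome (C.css.rowSpZ : Set (Mono ℓ m ⊕ Mono ℓ m → ZMod 2)) e),
        bernoulliWeight (1 / 4) (supp e) :=
  AbelianTwoBlock.quarter_le_zFailure_quarter (coeffVec C.A) (coeffVec C.B) hk D

open Classical in
/-- **`X`-sector twin**: every decoder fails with probability `≥ 1/4` on independent bit flips of rate `1/4`.
[cite: RichardsonUrbanke2008, Lemma 4.78; BravyiEtAl2024, §4 Lemma 1] -/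
theorem quarter_le_xFailure_quarter (C : BB.Code ℓ m) (hk : 0 < C.css.k)
    (D : Decoder (Mono ℓ m → ZMod 2) (Mono ℓ m ⊕ Mono ℓ m → ZMod 2)) :
    1 / 4 ≤ ∑ e ∈ univ.filter (fun e : Mono ℓ m ⊕ Mono ℓ m → ZMod 2 =>
        ¬ D.Corrects C.css.xSyndrome (C.css.rowSpX : Set (Mono ℓ m ⊕ Mono ℓ m → ZMod 2)) e),
        bernoulliWeight (1 / 4) (supp e) :=
  AbelianTwoBlock.quarter_le_xFailure_quarter (coeffVec C.A) (coeffVec C.B) hk D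

end BB.Code

end Literature.InformationTheory.QuantumCodes

end
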